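import Summits.KontsevichZagierPeriods.KontsevichZagierPeriods.Theorems.ValuedFieldSpecialisationCTConstructionBlowupBinomial
import Summits.KontsevichZagierPeriods.KontsevichZagierPeriods.Theorems.ValuedFieldSpecialisationCTConstructionBlowupPlumbing

/-!
# Route ValuedFieldSpecialisation — crux `CTConstruction`: the blow-up preserves the power block

Helper toward crux stmt-KontsevichZagierPeriods-3495 (`CTConstruction`), line `registered`, reshape r4
(blow-up elimination of the log block; lead file). The POWER generators — elementary divergent products
`P(p, q, b, r)` with `0 < p < q` over arbitrary fibre representations `r` — generate a subgroup of
`KZ.FormalRep` which the blow-up `β = FreeAbelianGroup.lift Tβ` maps into itself MODULO FIBRED RELATIONS: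
by the binomial law (`blowup_binomial`) every piece of `β [P]` is again a power generator with the same
exponent `p/q`, over the fibre representations `Wₙ(p, q, r)`. Hence so do `T = 2β − 1` and all its
iterates (`blowupT_iterate_pow`). No identity between classes is needed here (contrast with the log
block, `…BlowupNilpotence`). The subgroup is contained in the one of `stub_powerOnly_reduction`
(`closure_powLt_le_closure_pow`).

Sources: M. Kontsevich, D. Zagier, *Periods* (2001), §1.2; the blow-up calculus is this route's.
No new definitions.
-/

noncomputable section

namespace Summit.KontsevichZagierPeriods.ValuedFieldSpecialisation

open MeasureTheory Set Filter
open scoped Topology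
open Literature.NumberTheory.Transcendental Literature.NumberTheory.Transcendental.KZ

/-- The power generators with `p < q` lie in the subgroup generated by all power generators
(`0 < p`, the generator set of `stub_powerOnly_reduction`). [folklore] -/
theorem closure_powLt_le_closure_pow :
    AddSubgroup.closure {x : Literature.NumberTheory.Transcendental.KZ.FormalRep | ∃ (p q b d : ℕ) (r : Literature.NumberTheory.Transcendental.KZ.IntegralRep d) (P : Literature.NumberTheory.Transcendental.KZ.IntegralRep (b + d + 1 + 1)), 0 < p ∧ p < q ∧ P.domain = {z | ∃ (s u : ℝ) (y : Fin b → ℝ) (w : Fin d → ℝ), z = Matrix.vecCons s (Matrix.vecCons u (Fin.append y w)) ∧ 0 < s ∧ s < 1 ∧ 0 < u ∧ u ^ q * s ^ p < 1 ∧ (∀ j, s ≤ y j ∧ y j ≤ 1) ∧ w ∈ r.domain} ∧ P.integrand = (fun z => (∏ j : Fin b, (z (Fin.castAdd d j).succ.succ)⁻¹) * r.integrand (fun l : Fin d => z (Fin.natAdd b l).succ.succ)) ∧ x = Literature.NumberTheory.Transcendental.KZ.of P} ≤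
    AddSubgroup.closure {x : Literature.NumberTheory.Transcendental.KZ.FormalRep | ∃ (p q b d : ℕ) (r : Literature.NumberTheory.Transcendental.KZ.IntegralRep d) (P : Literature.NumberTheory.Transcendental.KZ.IntegralRep (b + d + 1 + 1)), 0 < q ∧ 0 < p ∧ P.domain = {z | ∃ (s u : ℝ) (y : Fin b → ℝ) (w : Fin d → ℝ), z = Matrix.vecCons s (Matrix.vecCons u (Fin.append y w)) ∧ 0 < s ∧ s < 1 ∧ 0 < u ∧ u ^ q * s ^ p < 1 ∧ (∀ j, s ≤ y j ∧ y j ≤ 1) ∧ w ∈ r.domain} ∧ P.integrand = (fun z => (∏ j : Fin b, (z (Fin.castAdd d j).succ.succ)⁻¹) * r.integrand (fun l : Fin d => z (Fin.natAdd b l).succ.succ)) ∧ x = Literature.NumberTheory.Transcendental.KZ.of P} := by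
  refine AddSubgroup.closure_mono ?_
  rintro x ⟨p, q, b, d, r, P, hp, hpq, hPd, hPi, rfl⟩
  exact ⟨p, q, b, d, r, P, lt_of_le_of_lt (Nat.zero_le p) hpq, hp, hPd, hPi, rfl⟩

section Power

variable {Tβ : (Σ n, IntegralRep n) → FormalRep}
  (hT0 : ∀ ρ : IntegralRep 0, Tβ ⟨0, ρ⟩ = 0)
  (hT : ∀ (n : ℕ) (ρ : IntegralRep (n + 1)), ∃ ρ' : IntegralRep (n + 1 + 1), Tβ ⟨n + 1, ρ⟩ = of ρ' ∧
    ρ'.domain = {z | 0 < z 1 ∧ z 1 < z 0 ∧ z 0 < 1 ∧ (fun i : Fin (n + 1) => z i.succ) ∈ ρ.domain} ∧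
    ρ'.integrand = fun z => z 1 / z 0 ^ 2 * ρ.integrand (fun i : Fin (n + 1) => z i.succ))

include hT in
/-- **The blow-up maps the power subgroup into itself modulo fibred relations**: for `x` in the
subgroup generated by the power generators (`0 < p < q`) there is `x'` in it with
`β x − x' ∈ KZ.fibredRelations` (binomial law on generators, additivity of `β`). [folklore] -/
theorem blowup_pow_closure :
    ∀ x ∈ AddSubgroup.closure {x : Literature.NumberTheory.Transcendental.KZ.FormalRep | ∃ (p q b d : ℕ) (r : Literature.NumberTheory.Transcendental.KZ.IntegralRep d) (P : Literature.NumberTheory.Transcendental.KZ.IntegralRep (b + d + 1 + 1)), 0 < p ∧ p < q ∧ P.domain = {z | ∃ (s u : ℝ) (y : Fin b → ℝ) (w : Fin d → ℝ), z = Matrix.vecCons s (Matrix.vecCons u (Fin.append y w)) ∧ 0 < s ∧ s < 1 ∧ 0 < u ∧ u ^ q * s ^ p < 1 ∧ (∀ j, s ≤ y j ∧ y j ≤ 1) ∧ w ∈ r.domain} ∧ P.integrand = (fun z => (∏ j : Fin b, (z (Fin.castAdd d j).succ.succ)⁻¹) * r.integrand (fun l : Fin d => z (Fin.natAdd b l).succ.succ))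 ∧ x = Literature.NumberTheory.Transcendental.KZ.of P},
      ∃ x' ∈ AddSubgroup.closure {x : Literature.NumberTheory.Transcendental.KZ.FormalRep | ∃ (p q b d : ℕ) (r : Literature.NumberTheory.Transcendental.KZ.IntegralRep d) (P : Literature.NumberTheory.Transcendental.KZ.IntegralRep (b + d + 1 + 1)), 0 < p ∧ p < q ∧ P.domain = {z | ∃ (s u : ℝ) (y : Fin b → ℝ) (w : Fin d → ℝ), z = Matrix.vecCons s (Matrix.vecCons u (Fin.append y w)) ∧ 0 < s ∧ s < 1 ∧ 0 < u ∧ u ^ q * s ^ p < 1 ∧ (∀ j, s ≤ y j ∧ y j ≤ 1) ∧ w ∈ r.domain} ∧ P.integrand = (fun z => (∏ j : Fin b, (z (Fin.castAdd d j).succ.succ)⁻¹) * r.integrand (fun l : Fin d => z (Fin.natAdd b l).succ.succ)) ∧ x = Literature.NumberTheory.Transcendental.KZ.of P},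
        FreeAbelianGroup.lift Tβ x - x' ∈ fibredRelations := by
  intro x hx
  refine AddSubgroup.closure_induction (fun x hx => ?_) ?_ (fun x y _ _ hx hy => ?_) (fun x _ hx => ?_) hx
  · obtain ⟨p, q, b, d, r, P, hp, hpq, hPd, hPi, rfl⟩ := hx
    obtain ⟨W, P', hW, hP', hrel⟩ := blowup_binomial hT hpq r P hPd hPi
    refine ⟨∑ n ∈ Finset.range (b + 1), (b.choose n) • of (P' n), ?_, hrel⟩
    refine AddSubgroup.sum_mem _ fun n _ => AddSubgroup.nsmul_mem _ (AddSubgroup.subset_closure ?_) _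
    exact ⟨p, q, b - n, n + d + 1, W n, P' n, hp, hpq, (hP' n).1, (hP' n).2, rfl⟩
  · exact ⟨0, AddSubgroup.zero_mem _, by simp [fibredRelations.zero_mem]⟩
  · obtain ⟨x', hx', hx''⟩ := hx
    obtain ⟨y', hy', hy''⟩ := hy
    refine ⟨x' + y', AddSubgroup.add_mem _ hx' hy', ?_⟩
    rw [map_add]
    convert fibredRelations.add_mem hx'' hy'' using 1
    abel
  · obtain ⟨x', hx', hx''⟩ := hx
    refine ⟨-x', AddSubgroup.neg_mem _ hx', ?_⟩
    rw [map_neg]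
    convert fibredRelations.neg_mem hx'' using 1
    abel

include hT0 hT in
/-- **All iterates of `T = 2β − 1` map the power subgroup into itself modulo fibred relations.**
[folklore] -/
theorem blowupT_iterate_pow (n : ℕ) :
    ∀ x ∈ AddSubgroup.closure {x : Literature.NumberTheory.Transcendental.KZ.FormalRep | ∃ (p q b d : ℕ) (r : Literature.NumberTheory.Transcendental.KZ.IntegralRep d) (P : Literature.NumberTheory.Transcendental.KZ.IntegralRep (b + d + 1 + 1)), 0 < p ∧ p < q ∧ P.domain = {z | ∃ (s u : ℝ) (y : Fin b → ℝ) (w : Fin d → ℝ), z = Matrix.vecCons s (Matrix.vecCons u (Fin.append y w)) ∧ 0 < s ∧ s < 1 ∧ 0 < u ∧ u ^ q * s ^ p < 1 ∧ (∀ j, s ≤ y j ∧ y j ≤ 1) ∧ w ∈ r.domain} ∧ P.integrand = (fun z => (∏ j : Fin b, (z (Fin.castAdd d j).succ.succ)⁻¹) * r.integrand (fun l : Fin d => z (Fin.natAdd b l).succ.succ)) ∧ x = Literature.NumberTheory.Transcendental.KZ.of P},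
      ∃ x' ∈ AddSubgroup.closure {x : Literature.NumberTheory.Transcendental.KZ.FormalRep | ∃ (p q b d : ℕ) (r : Literature.NumberTheory.Transcendental.KZ.IntegralRep d) (P : Literature.NumberTheory.Transcendental.KZ.IntegralRep (b + d + 1 + 1)), 0 < p ∧ p < q ∧ P.domain = {z | ∃ (s u : ℝ) (y : Fin b → ℝ) (w : Fin d → ℝ), z = Matrix.vecCons s (Matrix.vecCons u (Fin.append y w)) ∧ 0 < s ∧ s < 1 ∧ 0 < u ∧ u ^ q * s ^ p < 1 ∧ (∀ j, s ≤ y j ∧ y j ≤ 1) ∧ w ∈ r.domain} ∧ P.integrand = (fun z => (∏ j : Fin b, (z (Fin.castAdd d j).succ.succ)⁻¹) * r.integrand (fun l : Fin d => z (Fin.natAdd b l).succ.succ)) ∧ x = Literature.NumberTheory.Transcendental.KZ.of P},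
        (fun x => 2 • FreeAbelianGroup.lift Tβ x - x)^[n] x - x' ∈ fibredRelations := by
  induction n with
  | zero => exact fun x hx => ⟨x, hx, by simp [fibredRelations.zero_mem]⟩
  | succ n ih =>
    intro x hx
    obtain ⟨xₙ, hxₙ, hrelₙ⟩ := ih x hx
    obtain ⟨x', hx', hrel'⟩ := blowup_pow_closure hT xₙ hxₙ
    refine ⟨2 • x' - xₙ, AddSubgroup.sub_mem _ (AddSubgroup.nsmul_mem _ hx' 2) hxₙ, ?_⟩
    rw [Function.iterate_succ_apply']
    -- `T (T^[n] x) − T xₙ ∈ fibredRelations` and `T xₙ − (2 • x' − xₙ) = 2 • (β xₙ − x')`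
    have h1 : (2 • FreeAbelianGroup.lift Tβ ((fun x => 2 • FreeAbelianGroup.lift Tβ x - x)^[n] x) -
        (fun x => 2 • FreeAbelianGroup.lift Tβ x - x)^[n] x) -
        (2 • FreeAbelianGroup.lift Tβ xₙ - xₙ) ∈ fibredRelations := by
      rw [← blowupT_map_sub]
      exact blowupT_mem_fibredRelations hT0 hT hrelₙ
    have h2 : (2 • FreeAbelianGroup.lift Tβ xₙ - xₙ) - (2 • x' - xₙ) ∈ fibredRelations := by
      convert fibredRelations.nsmul_mem hrel' 2 using 1
      rw [smul_sub]
      abel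
    have := fibredRelations.add_mem h1 h2
    convert this using 1
    abel

end Power

/-- **Registered stub `stub_blowupT_pow`** (crux `CTConstruction`, line `registered`, reshape r4): all
iterates of `T = 2β − 1` preserve the power subgroup modulo fibred relations, explicit form of
`blowupT_iterate_pow`. [folklore] -/
theorem stub_blowupT_pow : ∀ (Tβ : (Σ n, Literature.NumberTheory.Transcendental.KZ.IntegralRep n) → Literature.NumberTheory.Transcendental.KZ.FormalRep), (∀ ρ : Literature.NumberTheory.Transcendental.KZ.IntegralRep 0, Tβ ⟨0, ρ⟩ = 0) → (∀ (n : ℕ) (ρ : Literature.NumberTheory.Transcendental.KZ.IntegralRep (n + 1)), ∃ ρ' : Literature.NumberTheory.Transcendental.KZ.IntegralRep (n + 1 + 1), Tβ ⟨n + 1, ρ⟩ = Literature.NumberTheory.Transcendental.KZ.of ρ' ∧ ρ'.domain = {z | 0 < z 1 ∧ z 1 < z 0 ∧ z 0 < 1 ∧ (fun i : Fin (n + 1) => z i.succ) ∈ ρ.domain} ∧ ρ'.integrand = fun z => z 1 / z 0 ^ 2 * ρ.integrand (fun i : Fin (n + 1) => z i.succ)) → ∀ (n : ℕ), ∀ x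 ∈ AddSubgroup.closure {x : Literature.NumberTheory.Transcendental.KZ.FormalRep | ∃ (p q b d : ℕ) (r : Literature.NumberTheory.Transcendental.KZ.IntegralRep d) (P : Literature.NumberTheory.Transcendental.KZ.IntegralRep (b + d + 1 + 1)), 0 < p ∧ p < q ∧ P.domain = {z | ∃ (s u : ℝ) (y : Fin b → ℝ) (w : Fin d → ℝ), z = Matrix.vecCons s (Matrix.vecCons u (Fin.append y w)) ∧ 0 < s ∧ s < 1 ∧ 0 < u ∧ u ^ q * s ^ p < 1 ∧ (∀ j, s ≤ y j ∧ y j ≤ 1) ∧ w ∈ r.domain} ∧ P.integrand = (fun z => (∏ j : Fin b, (z (Fin.castAdd d j).succ.succ)⁻¹) * r.integrand (fun l : Fin d => z (Fin.natAdd b l).succ.succ)) ∧ x = Literature.NumberTheory.Transcendental.KZ.of P}, ∃ x' ∈ AddSubgroup.closure {x : Literature.NumberTheory.Transcendental.KZ.FormalRep | ∃ (p q b d : ℕ) (r : Literature.NumberTheory.Transcendental.KZ.IntegralRep d) (P : Literature.NumberTheory.Transcendental.KZ.IntegralRep (b + d + 1 + 1)), 0 < p ∧ p < q ∧ P.domain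 = {z | ∃ (s u : ℝ) (y : Fin b → ℝ) (w : Fin d → ℝ), z = Matrix.vecCons s (Matrix.vecCons u (Fin.append y w)) ∧ 0 < s ∧ s < 1 ∧ 0 < u ∧ u ^ q * s ^ p < 1 ∧ (∀ j, s ≤ y j ∧ y j ≤ 1) ∧ w ∈ r.domain} ∧ P.integrand = (fun z => (∏ j : Fin b, (z (Fin.castAdd d j).succ.succ)⁻¹) * r.integrand (fun l : Fin d => z (Fin.natAdd b l).succ.succ)) ∧ x = Literature.NumberTheory.Transcendental.KZ.of P}, (fun x => 2 • FreeAbelianGroup.lift Tβ x - x)^[n] x - x' ∈ Literature.NumberTheory.Transcendental.KZ.fibredRelations :=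
  fun _ hT0 hT n => blowupT_iterate_pow hT0 hT n

end Summit.KontsevichZagierPeriods.ValuedFieldSpecialisation
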